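import Summits.ValiantsHypothesis.ValiantsHypothesis.Theorems.DivisionGapPerDivisionHardStubMagnetRigid
import Summits.ValiantsHypothesis.ValiantsHypothesis.Theorems.DivisionGapPerDivisionHardStubPricedCut
import Summits.ValiantsHypothesis.ValiantsHypothesis.Theorems.DivisionGapPerDivisionHardStubClosedWalkSumTorus
import Summits.ValiantsHypothesis.ValiantsHypothesis.Theorems.DivisionGapPerDivisionHardStubSparseRigidCount

/-!
# Crux `DivisionGap.PerDivisionHard` (stmt-ValiantsHypothesis-5065), line `pair-descent-jss-endpoint` —
the STEERING PIPELINE end to end: a single `G`-part for the closed walk sum under an admissible steered weight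

Seat c8 (dossier v8, `Cruxes/PerDivisionHard/NegativeNotes-genericCut-walkTwins.md`): the closed walk sums
`closedWalkSum n L R₀ ρ₀ a₀` (factors of the walk-sum cofactor `h_walk`) are NON-rigid under every one-scale cut
(the reversal twins), but multi-scale prices MAGNETISE.  This file composes the three landed pieces —
`stub_magnetRigid` (four magnet prices make the price functional uniquely minimised), `stub_pricedCut` (prices →
an admissible weight whose top fibre is the set of price minimisers) and `stub_closedWalkSum_torus` (equal degrees)
— into the statement the line's glue consumes: `CutsOut w (placedBlock eR eC) ∧ HasSingleGPart … w (closedWalkSum …) u`.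
It is the first kernel-checked instance of "steered weights succeed where one-scale cuts fail".

* `magnet_hasSingleGPart`.
-/

noncomputable section

-- `Summit.ValiantsHypothesis.ValiantsHypothesis.…` is the tree's mandated single-conjunct layout
-- (Sub = Summit), so the duplicated namespace component is intended.
set_option linter.dupNamespace false

namespace Summit.ValiantsHypothesis.ValiantsHypothesis.Theorems.DivisionGapPerDivisionHard

open MvPolynomial Literature.Computability.AlgebraicComplexity
open Summit.ValiantsHypothesis.ValiantsHypothesis.Theorems.ZeroOneTransfer.Negative (topComponent topComponent_ne_zero)
open scoped NNReal BigOperators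

/-- **The steering pipeline, end to end.**  For every placement of a block gadget with `m ≥ 8` padding
vertices, every even `L ≥ 2` and `R₀ ≠ ρ₀`, the nonzero closed walk sum `W_L^{(R₀;ρ₀,a₀)}` has a SINGLE `G`-part
under some ADMISSIBLE weight: magnet prices (`stub_magnetRigid`) → the priced cut with no lures (`stub_pricedCut`,
`P = Q = ∅`; equal degrees from `stub_closedWalkSum_torus`) → the top fibre is the unique price minimiser →
`HasSingleGPart` with `u` its restriction to the face. [folklore] -/
theorem magnet_hasSingleGPart (b k m n L : ℕ) (eR eC : BlockV b k m ≃ Fin n) (R₀ ρ₀ a₀ : Fin n)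
    (hL : Even L) (h2 : 2 ≤ L) (hm : 8 ≤ m) (hne : R₀ ≠ ρ₀) (hW : closedWalkSum n L R₀ ρ₀ a₀ ≠ 0) :
    ∃ (w : Fin n × Fin n → ℕ) (u : (Fin n × Fin n) →₀ ℕ),
      CutsOut w (placedBlock eR eC) ∧ HasSingleGPart (placedBlock eR eC) w (closedWalkSum n L R₀ ρ₀ a₀) u := by
  classical
  set W := closedWalkSum n L R₀ ρ₀ a₀ with hWdef
  obtain ⟨pr, hpr1, huniq⟩ := stub_magnetRigid b k m n L eR eC R₀ ρ₀ a₀ hL h2 hm hne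
  -- equal degrees from torus homogeneity
  have hdeg : ∀ m₁ ∈ W.support, ∀ m₂ ∈ W.support, m₁.degree = m₂.degree := by
    obtain ⟨r, c, hrc⟩ := stub_closedWalkSum_torus n L R₀ ρ₀ a₀
    intro m₁ hm₁ m₂ hm₂
    exact degree_eq_of_rowDegrees_eq (by rw [(hrc m₁ hm₁).1, (hrc m₂ hm₂).1])
  -- the priced cut with no lures
  have hoff : ∀ e : Fin n × Fin n, e ∉ placedBlock eR eC →
      (¬ ∃ p ∈ (∅ : Finset (Fin m)), ∃ q ∈ (∅ : Finset (Fin m)),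
        e = (eR (Sum.inr (Sum.inr p)), eC (Sum.inr (Sum.inr q)))) → 1 ≤ pr e :=
    fun e he _ => hpr1 e he
  obtain ⟨w, hcut, hfib⟩ := stub_pricedCut b k m n eR eC ∅ ∅ pr W (Finset.disjoint_empty_left _) hoff hdeg
  -- the two price sums coincide (no lure cells)
  have hfilter : (Finset.univ : Finset (Fin n × Fin n)).filter (fun e => e ∉ placedBlock eR eC ∧
      ¬ ∃ p ∈ (∅ : Finset (Fin m)), ∃ q ∈ (∅ : Finset (Fin m)),
        e = (eR (Sum.inr (Sum.inr p)), eC (Sum.inr (Sum.inr q)))) =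
      (Finset.univ : Finset (Fin n × Fin n)).filter (fun e => e ∉ placedBlock eR eC) := by
    refine Finset.filter_congr ?_
    intro e _
    simp
  -- a fibre element and uniqueness
  have hne0 : topComponent w W ≠ 0 := topComponent_ne_zero w hW
  obtain ⟨mo₀, hmo₀⟩ := MvPolynomial.support_nonempty.mpr hne0
  have hmin : ∀ mo ∈ (topComponent w W).support, mo ∈ W.support ∧ ∀ x ∈ W.support,
      (∑ e ∈ (Finset.univ : Finset (Fin n × Fin n)).filter (fun e => e ∉ placedBlock eR eC), pr e * mo e) ≤
        ∑ e ∈ (Finset.univ : Finset (Fin n × Fin n)).filter (fun e => e ∉ placedBlock eR eC), pr e * x e := by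
    intro mo hmo
    obtain ⟨hsupp, hle⟩ := (hfib mo).mp hmo
    refine ⟨hsupp, fun x hx => ?_⟩
    have := hle x hx
    rwa [hfilter] at this
  have hall : ∀ mo ∈ (topComponent w W).support, mo = mo₀ := by
    intro mo hmo
    obtain ⟨h1, h2'⟩ := hmin mo hmo
    obtain ⟨h3, h4⟩ := hmin mo₀ hmo₀
    exact huniq mo h1 mo₀ h3 h2' h4
  refine ⟨w, mo₀.filter (fun e => e ∈ placedBlock eR eC), hcut, ?_, ?_⟩
  · intro e he
    rw [Finsupp.support_filter] at he
    exact (Finset.mem_filter.mp he).2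
  · intro mo hmo e he
    rw [hall mo hmo, Finsupp.filter_apply_pos _ _ he]


/-- **∀-form (registered marker `stub_magnetSingleGPart` of the line's skeleton).**  The steering pipeline end to end: for every
placement with `m ≥ 8` and every nonzero closed-walk sum there are an admissible weight `w` and an exponent `u` with
`HasSingleGPart (placedBlock eR eC) w (closedWalkSum n L R₀ ρ₀ a₀) u`. [folklore] -/
theorem stub_magnetSingleGPart :
    ∀ (b k m n L : ℕ) (eR eC : BlockV b k m ≃ Fin n) (R₀ ρ₀ a₀ : Fin n),
      Even L → 2 ≤ L → 8 ≤ m → R₀ ≠ ρ₀ → closedWalkSum n L R₀ ρ₀ a₀ ≠ 0 →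
      ∃ (w : Fin n × Fin n → ℕ) (u : (Fin n × Fin n) →₀ ℕ),
        CutsOut w (placedBlock eR eC) ∧ HasSingleGPart (placedBlock eR eC) w (closedWalkSum n L R₀ ρ₀ a₀) u :=
  fun b k m n L eR eC R₀ ρ₀ a₀ hL h2 hm hne hW => magnet_hasSingleGPart b k m n L eR eC R₀ ρ₀ a₀ hL h2 hm hne hW

end Summit.ValiantsHypothesis.ValiantsHypothesis.Theorems.DivisionGapPerDivisionHard

end
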